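import Summits.BirchSwinnertonDyer.BirchSwinnertonDyer.Theses.ByReductionTypeAtTwo
import Summits.BirchSwinnertonDyer.BirchSwinnertonDyer.Theorems.ByReductionTypeAtTwoRankOneAtTwoBigImageOddLocalOneDoorGlue
import HarnessLib

/-!
# Route ByReductionTypeAtTwo, crux `RankOneAtTwoBigImageOddLocal` (stmt-BirchSwinnertonDyer-23715), line `one_door_law`:
# the crux BY NAME from the line's five inputs (kernel-checked composition of the registered skeleton, glue discharged)

Lead prover seat `bsd-line-fkl-p1` g6 (2026-08-28).  With the glue `stub_doorGlue : S_doorGlue` PROVED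
(`…OneDoorGlue.lean`), the registered skeleton `Cruxes/RankOneAtTwoBigImageOddLocal/Lines/one_door_law.lean` (v7.1 → v7.2)
composes to the route crux from FIVE named statements of the tree (`Theorems/…OneDoorLawDefs.lean`, p610929):

  `S_pub → DoorIndexLawAtTwo → DoorTwistValueAtTwo → DoorSupplyAtTwo → S_manin → RankOneAtTwoBigImageOddLocal`.

Status of the five (honest): `S_pub` = published inputs as named facts of the tree (Gross–Zagier I.6.3 `gross_zagier`, Kolyvagin
`kolyvagin`, GZK over `ℚ` `rank_eq_analyticRank_of_analyticRank_le_one`, modularity `hasEntireLFunction_rat`; the Heegner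
rationality conjunct is a tree THEOREM); `DoorIndexLawAtTwo` = the lens' CONJECTURE AN-27 (the `2`-part of rank-one BSD in
Heegner-index currency — the crux's load-bearing statement); `DoorTwistValueAtTwo` = rank-`0` value law of the `Sel₂`-trivial door
twist INCLUDING the rank-`0` `2`-converse (open in print for non-CM curves); `DoorSupplyAtTwo` = existence of a `Sel₂`-trivialising
door field (theorem on paper, Mazur–Rubin 2010 §3 + Čebotarev; not yet in the kernel); `S_manin` = odd parametrisation constant
(theorem for `4 ∤ N`, open for `4 ∣ N`).  BSD is not proved by any of this; nothing here is asserted unconditionally about BSD.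
-/

set_option autoImplicit false

noncomputable section

open scoped Classical

set_option linter.dupNamespace false

namespace Summit.BirchSwinnertonDyer.BirchSwinnertonDyer.Theorems.RankOneAtTwoOneDoor

open WeierstrassCurve Literature.NumberTheory.EllipticCurves Literature.NumberTheory.EllipticCurves.ModularForms
  Summit.BirchSwinnertonDyer.BirchSwinnertonDyer.Theses.ByReductionTypeAtTwo

/-- **The crux `RankOneAtTwoBigImageOddLocal` BY NAME from the five inputs of the line `one_door_law`** (the registered
skeleton's `comp` with the glue stub discharged by the tree theorem `stub_doorGlue`): GZK turns `analyticRank = 1` into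
`mordellWeilRank = 1`, and `S_sliceMW` (the glue's conclusion) is the crux with that rank hypothesis added. -/
theorem rankOneAtTwoBigImageOddLocal_of_oneDoor (hpub : S_pub) (hIdx : DoorIndexLawAtTwo)
    (hVal : DoorTwistValueAtTwo) (hSup : DoorSupplyAtTwo) (hMan : S_manin) : RankOneAtTwoBigImageOddLocal := by
  intro W _ _ hCM hsurj hT hc hr
  have hrk : W.mordellWeilRank = 1 := by
    have h := (hpub.2.1 W (le_of_eq hr)).1
    rw [h, hr]
  exact stub_doorGlue hpub hIdx hVal hSup hMan W hCM hsurj hT hc hr hrk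

/-- The same with `S_pub` opened into its named published inputs (all tree names; the Heegner-rationality conjunct is
discharged by the tree theorem `heegnerPointComplex_mem_range_map_holds`): Gross–Zagier and Kolyvagin for every level / curve /
field, GZK over `ℚ`, modularity. -/
theorem rankOneAtTwoBigImageOddLocal_of_oneDoor_primary
    (hGZ : ∀ (N : ℕ) [NeZero N] (W : WeierstrassCurve ℚ) (K : Type) [Field K] [NumberField K], gross_zagier N W K)
    (hKo : ∀ (N : ℕ) [NeZero N] (W : WeierstrassCurve ℚ) (K : Type) [Field K] [NumberField K], kolyvagin N W K)
    (hGZK : rank_eq_analyticRank_of_analyticRank_le_one) (hmod : WeierstrassCurve.hasEntireLFunction_rat)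
    (hIdx : DoorIndexLawAtTwo) (hVal : DoorTwistValueAtTwo) (hSup : DoorSupplyAtTwo) (hMan : S_manin) :
    RankOneAtTwoBigImageOddLocal :=
  rankOneAtTwoBigImageOddLocal_of_oneDoor
    ⟨fun N _ W K _ _ => ⟨hGZ N W K, hKo N W K, heegnerPointComplex_mem_range_map_holds N W K⟩, hGZK, hmod⟩
    hIdx hVal hSup hMan

end Summit.BirchSwinnertonDyer.BirchSwinnertonDyer.Theorems.RankOneAtTwoOneDoor

end
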